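import Summits.CriticalPhenomena.CardyFormulaZ2.Theorems.RectilinearCardy.Negative.RectilinearCardyLShape
import Summits.CriticalPhenomena.CardyFormulaZ2.Theorems.CardyWhiteToColouredSimilarityUpgradeStubRectangleFamily
import Literature.Probability.RandomPlanarGeometry.RectangleModulusAspectRatio
import Mathlib.Analysis.Convex.Basic
import Mathlib.Analysis.Convex.Topology

/-!
# Stub `stub_heartNeedsFullLimit` (line `registered`, crux `SimilarityUpgrade`, stmt-CriticalPhenomena-4597)

Crux `Summit.CriticalPhenomena.CardyFormulaZ2.Theses.CardyWhiteToColoured.SimilarityUpgrade`,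
line `registered`, stub **G**: *tightness* of the registered heart. The heart says that a FULL
bond-`ℤ²` crossing limit `Φ` which is similarity invariant takes the same value on a rectilinear
conformal rectangle `R` and on a corner-marked box `R'` of the same modulus. This file shows that
the full-limit clause cannot be dropped: similarity invariance alone does not make a functional of
conformal rectangles a function of the modulus.

Witness: `Φ R := if Convex ℝ R.carrier then 1 else 0`.

* `Φ` is similarity invariant: `z ↦ a z + w` (`a ≠ 0`) and its inverse are real-affine, so they
  preserve convexity of the carrier (`needsFullLimit_convex_image`, `needsFullLimit_convex_iff`).
* `R :=` the L-shape `lShapeQuad` (`RectilinearCardyLShape.lean`): rectilinear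
  (`isRectilinear_lShapeQuad`), modulus `1/2` (`crossRatio_lShapeQuad`), and NOT convex
  (`needsFullLimit_not_convex_lShapeQuad`): if its carrier `U` were convex then so is `closure U`,
  which contains the boundary points `2 + i`, `1 + 2i`, hence their midpoint `3/2 + 3i/2`; that
  point is off the hexagon `frontier U` (`frontier_lShapeQuad`), so it lies in `U = interior U`;
  then `1 + i = (2/3)(3/2 + 3i/2) + (1/3)·0` lies in `interior U`
  (`Convex.combo_interior_closure_mem_interior`, `0 ∈ frontier U ⊆ closure U`), contradicting
  `1 + i ∈ frontier U` (the reflex corner) and `U ∩ frontier U = ∅`.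
* `R' :=` the corner box `(0,w) × (0,1)` marked `i, 0, w, w + i` of modulus `1/2`
  (`RectangleFamily.surj`, `RectangleFamily.lr_family`, `RectangleFamily.lr_pt` of the sibling stub
  file `…StubRectangleFamily.lean`); its carrier is convex (`Complex.convexHull_reProdIm`).
* Uniformizing data exist for both (`MarkedDomain.exists_isUniformizing_holds`), with equal
  cross-ratios `1/2`, yet `Φ R = 0 ≠ 1 = Φ R'`.

References: B. Bollobás, O. Riordan, *Percolation* (2006), Ch. 7 §7.1; J. Cardy, J. Phys. A 25
(1992) L201.
-/

noncomputable section

namespace Summit.CriticalPhenomena.CardyFormulaZ2.Cruxes.SimilarityUpgrade.Stubs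

open Filter Topology Set MeasureTheory
open Literature.Probability.RandomPlanarGeometry
open Literature.Probability.Percolation
open Summit.CriticalPhenomena.CardyFormulaZ2.Theorems.RectilinearCardy.Negative
  (lShapeQuad isRectilinear_lShapeQuad frontier_lShapeQuad crossRatio_lShapeQuad)

/-! ### Similarities preserve convexity -/

/-- The image of a convex subset of `ℂ` under `z ↦ a z + w` is convex. [folklore] -/
theorem needsFullLimit_convex_image {s : Set ℂ} (hs : Convex ℝ s) (a w : ℂ) :
    Convex ℝ ((fun z : ℂ => a * z + w) '' s) := by
  rintro _ ⟨x, hx, rfl⟩ _ ⟨y, hy, rfl⟩ t u ht hu htu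
  refine ⟨t • x + u • y, hs hx hy ht hu htu, ?_⟩
  have h1 : ((t : ℂ) + u) = 1 := by exact_mod_cast htu
  simp only [Complex.real_smul]
  linear_combination (-w) * h1

/-- Convexity of a subset of `ℂ` is invariant under the similarities `z ↦ a z + w`, `a ≠ 0`.
[folklore] -/
theorem needsFullLimit_convex_iff {s s' : Set ℂ} {a w : ℂ} (ha : a ≠ 0)
    (h : s' = (fun z : ℂ => a * z + w) '' s) : Convex ℝ s' ↔ Convex ℝ s := by
  have hs : s = (fun z : ℂ => a⁻¹ * z + -(a⁻¹ * w)) '' s' := by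
    rw [h, Set.image_image]
    have e : (fun z : ℂ => a⁻¹ * (a * z + w) + -(a⁻¹ * w)) = fun z => z := by
      funext z
      rw [mul_add, ← mul_assoc, inv_mul_cancel₀ ha, one_mul]
      ring
    rw [e, Set.image_id']
  constructor
  · intro h'
    rw [hs]
    exact needsFullLimit_convex_image h' _ _
  · intro h'
    rw [h]
    exact needsFullLimit_convex_image h' _ _

/-! ### The L-shape is not convex -/

/-- On a segment whose endpoints have the same real part, the real part is constant. [folklore] -/
theorem needsFullLimit_re_of_mem_segment {p q z : ℂ} (h : z ∈ segment ℝ p q) (hpq : p.re = q.re) :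
    z.re = p.re := by
  obtain ⟨a, b, -, -, hab, rfl⟩ := h
  simp only [Complex.add_re, Complex.smul_re, smul_eq_mul]
  rw [← hpq]
  linear_combination p.re * hab

/-- On a segment whose endpoints have the same imaginary part, the imaginary part is constant.
[folklore] -/
theorem needsFullLimit_im_of_mem_segment {p q z : ℂ} (h : z ∈ segment ℝ p q) (hpq : p.im = q.im) :
    z.im = p.im := by
  obtain ⟨a, b, -, -, hab, rfl⟩ := h
  simp only [Complex.add_im, Complex.smul_im, smul_eq_mul]
  rw [← hpq]
  linear_combination p.im * hab

/-- A point whose real and imaginary parts both avoid `{0, 1, 2}` is off the boundary hexagon of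
the L-shape (its six sides lie on the lines `im = 0`, `re = 2`, `im = 1`, `re = 1`, `im = 2`,
`re = 0`). [folklore] -/
theorem needsFullLimit_not_mem_frontier {z : ℂ} (hr0 : z.re ≠ 0) (hr1 : z.re ≠ 1) (hr2 : z.re ≠ 2)
    (hi0 : z.im ≠ 0) (hi1 : z.im ≠ 1) (hi2 : z.im ≠ 2) : z ∉ frontier lShapeQuad.carrier := by
  rw [frontier_lShapeQuad]
  rintro (((((h | h) | h) | h) | h) | h)
  · exact hi0 (by simpa using needsFullLimit_im_of_mem_segment h (by simp))
  · exact hr2 (by simpa using needsFullLimit_re_of_mem_segment h (by simp))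
  · exact hi1 (by simpa using needsFullLimit_im_of_mem_segment h (by simp))
  · exact hr1 (by simpa using needsFullLimit_re_of_mem_segment h (by simp))
  · exact hi2 (by simpa using needsFullLimit_im_of_mem_segment h (by simp))
  · exact hr0 (by simpa using needsFullLimit_re_of_mem_segment h (by simp))

/-- **The L-shape `(0,2)² ∖ [1,2]²` is not convex.** If its carrier `U` were convex: the boundary
points `2 + i`, `1 + 2i` lie in the convex set `closure U`, so does their midpoint `3/2 + 3i/2`,
which is off the hexagon, hence in `U`; then `1 + i`, a proper convex combination of this interior
point and the boundary point `0`, lies in `interior U = U` — but `1 + i` is the reflex corner, a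
frontier point of the open set `U`. [folklore] -/
theorem needsFullLimit_not_convex_lShapeQuad : ¬ Convex ℝ lShapeQuad.carrier := by
  intro hc
  have hA : (2 + Complex.I : ℂ) ∈ frontier lShapeQuad.carrier := by
    rw [frontier_lShapeQuad]
    exact Or.inl (Or.inl (Or.inl (Or.inl (Or.inr (right_mem_segment ℝ _ _)))))
  have hB : (1 + 2 * Complex.I : ℂ) ∈ frontier lShapeQuad.carrier := by
    rw [frontier_lShapeQuad]
    exact Or.inl (Or.inl (Or.inr (right_mem_segment ℝ _ _)))
  have hO : (0 : ℂ) ∈ frontier lShapeQuad.carrier := by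
    rw [frontier_lShapeQuad]
    exact Or.inl (Or.inl (Or.inl (Or.inl (Or.inl (left_mem_segment ℝ _ _)))))
  have hC : (1 + Complex.I : ℂ) ∈ frontier lShapeQuad.carrier := by
    rw [frontier_lShapeQuad]
    exact Or.inl (Or.inl (Or.inr (left_mem_segment ℝ _ _)))
  -- the midpoint of `2 + i` and `1 + 2i`
  set m : ℂ := (1 / 2 : ℝ) • (2 + Complex.I : ℂ) + (1 / 2 : ℝ) • (1 + 2 * Complex.I) with hm_def
  have hm_re : m.re = 3 / 2 := by
    simp only [hm_def, Complex.add_re, Complex.smul_re, smul_eq_mul, Complex.mul_re, Complex.I_re,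
      Complex.I_im, Complex.re_ofNat, Complex.im_ofNat, Complex.one_re]
    norm_num
  have hm_im : m.im = 3 / 2 := by
    simp only [hm_def, Complex.add_im, Complex.smul_im, smul_eq_mul, Complex.mul_im, Complex.I_re,
      Complex.I_im, Complex.re_ofNat, Complex.im_ofNat, Complex.one_im]
    norm_num
  have hm_cl : m ∈ closure lShapeQuad.carrier :=
    hc.closure (frontier_subset_closure hA) (frontier_subset_closure hB) (by norm_num)
      (by norm_num) (by norm_num)
  have hmU : m ∈ lShapeQuad.carrier := by
    rw [closure_eq_self_union_frontier] at hm_cl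
    rcases hm_cl with h | h
    · exact h
    · exact absurd h (needsFullLimit_not_mem_frontier (by rw [hm_re]; norm_num)
        (by rw [hm_re]; norm_num) (by rw [hm_re]; norm_num) (by rw [hm_im]; norm_num)
        (by rw [hm_im]; norm_num) (by rw [hm_im]; norm_num))
  -- `1 + i = (2/3) m + (1/3) 0` lies in the interior
  have hin : (2 / 3 : ℝ) • m + (1 / 3 : ℝ) • (0 : ℂ) ∈ interior lShapeQuad.carrier :=
    hc.combo_interior_closure_mem_interior (by rwa [lShapeQuad.isOpen.interior_eq])
      (frontier_subset_closure hO) (by norm_num) (by norm_num) (by norm_num)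
  have he : (2 / 3 : ℝ) • m + (1 / 3 : ℝ) • (0 : ℂ) = 1 + Complex.I := by
    apply Complex.ext
    · simp only [Complex.add_re, Complex.smul_re, smul_eq_mul, hm_re, Complex.zero_re,
        Complex.one_re, Complex.I_re]
      norm_num
    · simp only [Complex.add_im, Complex.smul_im, smul_eq_mul, hm_im, Complex.zero_im,
        Complex.one_im, Complex.I_im]
      norm_num
  rw [he, lShapeQuad.isOpen.interior_eq] at hin
  exact Set.disjoint_left.1 lShapeQuad.disjoint_carrier_frontier hin hC

/-! ### Boxes are convex -/

/-- An open box `(0,w) × (0,1)` is convex. [folklore] -/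
theorem needsFullLimit_convex_box (w : ℝ) : Convex ℝ (Ioo (0 : ℝ) w ×ℂ Ioo (0 : ℝ) 1) := by
  rw [← convexHull_eq_self, Complex.convexHull_reProdIm, (convex_Ioo _ _).convexHull_eq,
    (convex_Ioo _ _).convexHull_eq]

/-! ### The stub -/

/-- **stub_heartNeedsFullLimit (G): the heart is false without its full-limit clause.** It is NOT
true that every similarity-invariant functional `Φ` of conformal rectangles takes equal values on
a rectilinear conformal rectangle `R` and a corner-marked box `R'` of the same modulus. Witness
`Φ R := if Convex ℝ R.carrier then 1 else 0` (similarity invariant since similarities preserve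
convexity), `R :=` the L-shape `lShapeQuad` (rectilinear, modulus `1/2`, not convex) and `R' :=`
the corner box `(0,w) × (0,1)` marked `i, 0, w, w + i` of modulus `1/2` (`RectangleFamily.surj`;
convex): the hypotheses hold with `crossRatio x = 1/2 = crossRatio x'`, yet `Φ R = 0 ≠ 1 = Φ R'`.
[folklore] -/
theorem stub_heartNeedsFullLimit :
    ¬ (∀ Φ : ConformalRectangle → ℝ,
      (∀ (R R' : ConformalRectangle) (a w : ℂ), a ≠ 0 →
        R'.carrier = (fun z : ℂ => a * z + w) '' R.carrier →
        R'.arc 0 = (fun z : ℂ => a * z + w) '' R.arc 0 →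
        R'.arc 2 = (fun z : ℂ => a * z + w) '' R.arc 2 → Φ R' = Φ R) →
      ∀ (R R' : ConformalRectangle),
        (∃ S : Finset (ℂ × ℂ), (∀ p ∈ S, p.1.re = p.2.re ∨ p.1.im = p.2.im) ∧
          frontier R.carrier ⊆ ⋃ p ∈ S, segment ℝ p.1 p.2) →
        (∃ w : ℝ, 0 < w ∧ R'.carrier = (Ioo (0 : ℝ) w ×ℂ Ioo (0 : ℝ) 1) ∧
          R'.arc 0 = {z : ℂ | z.re = 0 ∧ z.im ∈ Icc (0 : ℝ) 1} ∧
          R'.arc 2 = {z : ℂ | z.re = w ∧ z.im ∈ Icc (0 : ℝ) 1} ∧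
          R'.pt 0 = Complex.I ∧ R'.pt 1 = 0 ∧ R'.pt 2 = (w : ℂ) ∧ R'.pt 3 = (w : ℂ) + Complex.I) →
        ∀ (φ : ConformalEquiv UpperHalfPlane.upperHalfPlaneSet R.carrier) (x : Fin 4 → ℝ)
          (φ' : ConformalEquiv UpperHalfPlane.upperHalfPlaneSet R'.carrier) (x' : Fin 4 → ℝ),
          R.IsUniformizing φ x → R'.IsUniformizing φ' x' → crossRatio x = crossRatio x' →
          Φ R = Φ R') := by
  classical
  intro H
  -- the witness functional and its similarity invariance
  have hsim : ∀ (R R' : ConformalRectangle) (a w : ℂ), a ≠ 0 →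
      R'.carrier = (fun z : ℂ => a * z + w) '' R.carrier →
      R'.arc 0 = (fun z : ℂ => a * z + w) '' R.arc 0 →
      R'.arc 2 = (fun z : ℂ => a * z + w) '' R.arc 2 →
      (fun Q : ConformalRectangle => if Convex ℝ Q.carrier then (1 : ℝ) else 0) R' =
        (fun Q : ConformalRectangle => if Convex ℝ Q.carrier then (1 : ℝ) else 0) R := by
    intro R R' a w ha hcar _ _
    show (if Convex ℝ R'.carrier then (1 : ℝ) else 0) = if Convex ℝ R.carrier then (1 : ℝ) else 0
    by_cases hR : Convex ℝ R.carrier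
    · rw [if_pos hR, if_pos ((needsFullLimit_convex_iff ha hcar).2 hR)]
    · rw [if_neg hR, if_neg (fun h => hR ((needsFullLimit_convex_iff ha hcar).1 h))]
  -- the corner-box family of the sibling stub file and a box of modulus `1/2`
  choose sh hsh using RectangleFamily.exists_shift3
  obtain ⟨Q', hQ'⟩ : ∃ Q' : ℝ → ConformalRectangle,
      ∀ (w : ℝ) (hw : 0 < w), Q' w = rectQuad 0 w 0 1 hw one_pos :=
    ⟨fun w => if h : 0 < w then rectQuad 0 w 0 1 h one_pos else rectQuad 0 1 0 1 one_pos one_pos,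
      fun w hw => dif_pos hw⟩
  obtain ⟨w, hw, hcr⟩ := RectangleFamily.surj sh hsh Q' hQ' (1 / 2) ⟨by norm_num, by norm_num⟩
  obtain ⟨hcar, ha0, ha2⟩ := RectangleFamily.lr_family sh hsh Q' hQ' w hw
  obtain ⟨p0, p1, p2, p3⟩ := RectangleFamily.lr_pt sh hsh Q' hQ' w hw
  -- uniformizing data
  obtain ⟨φ, x, hφ⟩ := MarkedDomain.exists_isUniformizing_holds lShapeQuad
  obtain ⟨φ', x', hφ'⟩ := MarkedDomain.exists_isUniformizing_holds (sh (Q' w))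
  have key := H (fun Q : ConformalRectangle => if Convex ℝ Q.carrier then (1 : ℝ) else 0) hsim
    lShapeQuad (sh (Q' w)) isRectilinear_lShapeQuad ⟨w, hw, hcar, ha0, ha2, p0, p1, p2, p3⟩
    φ x φ' x' hφ hφ' (by rw [crossRatio_lShapeQuad hφ, hcr φ' x' hφ'])
  have e : (if Convex ℝ lShapeQuad.carrier then (1 : ℝ) else 0) =
      if Convex ℝ (sh (Q' w)).carrier then (1 : ℝ) else 0 := key
  rw [if_neg needsFullLimit_not_convex_lShapeQuad, if_pos (hcar ▸ needsFullLimit_convex_box w)] at e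
  exact zero_ne_one e

end Summit.CriticalPhenomena.CardyFormulaZ2.Cruxes.SimilarityUpgrade.Stubs

end
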